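import Summits.QuantumFields.QCD.Theses.PauliWegnerSea
import Literature.MathematicalPhysics.QuantumFieldTheory.QCDTimeReflection

/-!
# Sketch — crux idea `rp-axis-anchor` for `PauliWegnerSea.OneScaleTrajectory` (stmt-QuantumFields-11513)

Crux-ideate round 1, ideator 1 (gen 2). First lemmas of the line "two convexities on the diagonal":
clause (i) of the crux (`m_f(k) > −1`, i.e. `|κ| < 1/6`) is exactly the printed range of site- AND
link-reflection positivity of `r = 1` Wilson quarks (Montvay–Münster (4.111); Lüscher 1977), so the
degenerate-tuple theories `det D_W(t)^{N_f} e^{−βS_W}` carry a strictly positive one-step transfer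
matrix. For the axial mean pion correlator `C(n) = E‖G(0, n e₀)‖_F²` this gives

* `AxisMaximalityAP` — the axis point dominates every point of its time slice (Hilbert–Schmidt
  Cauchy–Schwarz, finite-dimensional core `HilbertSchmidtAxisBound`);
* `LogConvexityAP` — `n ↦ C(n)` is log-convex and symmetric on the time circle;
* `LogConvexTransport` — pure real analysis: a log-convex symmetric positive sequence with ONE lower
  anchor at `ℓ₀` and an upper bound at `0` is bounded below by `ε (ε/A)^{n/ℓ₀}` at EVERY `n ≤ L/2`;
* `LyapunovLowerInterpolation` — log-convexity of `p ↦ log E X^p`: a lower bound on `E X^s`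
  (`s < 2`) from a lower bound on `E X²` and an upper bound on `E X^p` (`p > 2`).

All five are `Prop`s; `HilbertSchmidtAxisBound`, `LogConvexTransport` and `LyapunovLowerInterpolation` are
PROVED below (`…_holds`, sorry-free, axioms propext/Classical.choice/Quot.sound); `AxisMaximalityAP` and
`LogConvexityAP` are consequences of the printed RP theorem (Lüscher 1977; MM (4.111)) and are stated only. Time is coordinate `0`, as in `QCDOS`/`QCDTimeReflection`; the
antiperiodic operator `wilsonDiracAP` is the honest-trace form (the tree's `wilsonDirac` is
time-periodic: the card's stub `PeriodicImages` bridges the two).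
-/

namespace Summit.QuantumFields.QCD.Cruxes.OneScaleTrajectory.RpAxisAnchor

open scoped BigOperators Matrix ComplexConjugate
open MeasureTheory Filter Literature.MathematicalPhysics.QuantumFieldTheory
  Literature.MathematicalPhysics.QuantumLattice Literature.Probability.LatticeModels

/-- Finite-dimensional core of axis maximality: for every square matrix `B` and unitary `V`,
`|Tr (B V Bᴴ Vᴴ)| ≤ Tr (B Bᴴ)` (Hilbert–Schmidt Cauchy–Schwarz with `‖V B Vᴴ‖_HS = ‖B‖_HS`).
In the application `B = T^{(L−n)/2} P̂ T^{n/2}` and `V` = a spatial translation. [folklore] -/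
def HilbertSchmidtAxisBound : Prop :=
  ∀ (n : ℕ) (B V : Matrix (Fin n) (Fin n) ℂ), V ∈ Matrix.unitaryGroup (Fin n) ℂ →
    ‖(B * V * Bᴴ * Vᴴ).trace‖ ≤ ((B * Bᴴ).trace).re

/-- **Axis maximality (antiperiodic, degenerate `N_f = 2`, physical branch).** For `β ≥ 0`, bare
mass `t > −1` (`|κ| < 1/6`), every odd torus `2S+1` and every target point `v` of the fundamental
box, the `det²`-weighted (unnormalised) mean of the Frobenius-squared quark propagator from the
origin to `v` is at most the same quantity to the AXIS point `(v 0) e₀` of the same time slice: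
`E[det² ‖G(0,v)‖_F²] ≤ E[det² ‖G(0,(v₀,0,0,0))‖_F²]`. Content: `E[det² ‖G(0,v)‖²_F]` is the
RP-positive pion correlator `⟨Θ(P)(0) P(v)⟩` of the two-flavour theory; with the positive transfer
matrix `T` it equals `Tr[T^{L−n} P̂₀ T^n P̂_{z}] / …`, `P̂_z = U_z P̂₀ U_z⁻¹`, and
`HilbertSchmidtAxisBound` applies. [cite: Luscher1977] [cite: MontvayMunster1994, §4.2.3 (4.90), (4.111)] -/
def AxisMaximalityAP : Prop :=
  ∀ (β t : ℝ), 0 ≤ β → -1 < t → ∀ (S : ℕ), 1 ≤ S → ∀ (v : Site 4), v ∈ box 4 S →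
    (∫ U : GaugeConfig 4 (2 * S + 1) (Matrix.specialUnitaryGroup (Fin 3) ℂ),
        ‖(wilsonDiracAP (fundamentalRep (Fin 3)) U t 1).det‖ ^ 2 *
          (∑ a : Fin 3, ∑ i : Fin 4, ∑ b : Fin 3, ∑ j : Fin 4,
            ‖(wilsonDiracAP (fundamentalRep (Fin 3)) U t 1)⁻¹ (Torus.proj (2 * S + 1) 0, a, i)
                (Torus.proj (2 * S + 1) v, b, j)‖ ^ 2)
        ∂(wilsonMeasure (fundamentalRep (Fin 3)) β)) ≤
      (∫ U : GaugeConfig 4 (2 * S + 1) (Matrix.specialUnitaryGroup (Fin 3) ℂ),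
        ‖(wilsonDiracAP (fundamentalRep (Fin 3)) U t 1).det‖ ^ 2 *
          (∑ a : Fin 3, ∑ i : Fin 4, ∑ b : Fin 3, ∑ j : Fin 4,
            ‖(wilsonDiracAP (fundamentalRep (Fin 3)) U t 1)⁻¹ (Torus.proj (2 * S + 1) 0, a, i)
                (Torus.proj (2 * S + 1) (Pi.single 0 (v 0)), b, j)‖ ^ 2)
        ∂(wilsonMeasure (fundamentalRep (Fin 3)) β))

/-- **Log-convexity of the axial mean pion correlator (antiperiodic, degenerate `N_f = 2`).**
With `C(n) := E[det² ‖G(0, n e₀)‖_F²]` on the odd torus `2S+1`: `C(n+1)² ≤ C(n) C(n+2)` and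
`C(n) = C(2S+1−n)` — the spectral sum `Σ_{i,j} λ_i^{L−n} λ_j^n |⟨i|P̂|j⟩|²` of the positive transfer
matrix is a positive combination of log-linear functions of `n`. [cite: Luscher1977] [cite: MontvayMunster1994, §4.2.3 (4.111) and §4.1.3 (4.34)] -/
def LogConvexityAP : Prop :=
  ∀ (β t : ℝ), 0 ≤ β → -1 < t → ∀ (S : ℕ), 1 ≤ S →
    let C : ℕ → ℝ := fun n =>
      ∫ U : GaugeConfig 4 (2 * S + 1) (Matrix.specialUnitaryGroup (Fin 3) ℂ),
        ‖(wilsonDiracAP (fundamentalRep (Fin 3)) U t 1).det‖ ^ 2 *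
          (∑ a : Fin 3, ∑ i : Fin 4, ∑ b : Fin 3, ∑ j : Fin 4,
            ‖(wilsonDiracAP (fundamentalRep (Fin 3)) U t 1)⁻¹ (Torus.proj (2 * S + 1) 0, a, i)
                (Torus.proj (2 * S + 1) (Pi.single 0 (n : ℤ)), b, j)‖ ^ 2)
        ∂(wilsonMeasure (fundamentalRep (Fin 3)) β)
    (∀ n : ℕ, n + 2 ≤ 2 * S + 1 → C (n + 1) ^ 2 ≤ C n * C (n + 2)) ∧
      ∀ n : ℕ, n ≤ 2 * S + 1 → C n = C (2 * S + 1 - n)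

/-- **Transport of ONE anchor by log-convexity (provable now).** A positive, log-convex sequence
on `{0,…,L}`, symmetric under `n ↦ L − n`, bounded above by `A` at `0` and below by `ε ≤ A` at
`ℓ₀ ≤ L/2`, is bounded below by `ε (ε/A)^{n/ℓ₀}` at every `n ≤ L/2` (monotone for `n ≤ ℓ₀`, chord
extrapolation for `n ≥ ℓ₀`). With `ε = a_k^{c}`, `A = O(1)`, `ℓ₀ = K₀ log(1/a_k)/a_k` the rate is
`(c/K₀)·a_k` per step — physical precisely because of the log room. [folklore] -/
def LogConvexTransport : Prop :=
  ∀ (C : ℕ → ℝ) (L ℓ₀ : ℕ) (A ε : ℝ),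
    (∀ n, n ≤ L → 0 < C n) →
    (∀ n, n + 2 ≤ L → C (n + 1) ^ 2 ≤ C n * C (n + 2)) →
    (∀ n, n ≤ L → C n = C (L - n)) →
    C 0 ≤ A → 0 < ε → ε ≤ A → ε ≤ C ℓ₀ → 1 ≤ ℓ₀ → 2 * ℓ₀ ≤ L →
    ∀ n : ℕ, 2 * n ≤ L → ε * (ε / A) ^ ((n : ℝ) / ℓ₀) ≤ C n

/-- **Lyapunov lower interpolation (provable now).** For a non-negative random variable and
exponents `0 < s < 2 < p`: `(E X²)^{p−s} ≤ (E X^s)^{p−2} (E X^p)^{2−s}` — a LOWER bound on the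
`s`-moment from a lower bound on the second moment and an upper bound on the `p`-moment
(log-convexity of `p ↦ log E X^p`, Hölder). [cite: HardyLittlewoodPolya1952, Thm 18 and Thm 193 (Lyapunov)] -/
def LyapunovLowerInterpolation : Prop :=
  ∀ (Ω : Type) [MeasurableSpace Ω] (μ : Measure Ω) [IsProbabilityMeasure μ] (X : Ω → ℝ) (s p : ℝ),
    Measurable X → (∀ ω, 0 ≤ X ω) → 0 < s → s < 2 → 2 < p →
    Integrable (fun ω => X ω ^ p) μ →
    (∫ ω, X ω ^ (2 : ℝ) ∂μ) ^ (p - s) ≤ (∫ ω, X ω ^ s ∂μ) ^ (p - 2) * (∫ ω, X ω ^ p ∂μ) ^ (2 - s)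


/-! ### `HilbertSchmidtAxisBound` is provable now (and proved) -/

section HSProof

open Matrix Complex

variable {n : ℕ}

/-- `Re Tr (M Mᴴ) = Σ |M i j|²`. [folklore] -/
theorem re_trace_mul_conjTranspose (M : Matrix (Fin n) (Fin n) ℂ) :
    ((M * Mᴴ).trace).re = ∑ i, ∑ j, ‖M i j‖ ^ 2 := by
  simp only [Matrix.trace, Matrix.diag, Matrix.mul_apply, Matrix.conjTranspose_apply,
    Complex.star_def, Complex.mul_conj, Complex.re_sum, Complex.ofReal_re,
    Complex.normSq_eq_norm_sq]

/-- `0 ≤ Re Tr (M Mᴴ)`. [folklore] -/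
theorem re_trace_mul_conjTranspose_nonneg (M : Matrix (Fin n) (Fin n) ℂ) :
    0 ≤ ((M * Mᴴ).trace).re := by
  rw [re_trace_mul_conjTranspose]
  positivity

/-- Hilbert–Schmidt Cauchy–Schwarz: `|Tr (B V Bᴴ Vᴴ)| ≤ Re Tr (B Bᴴ)` for unitary `V`
(polarisation: `0 ≤ Re Tr((B − cW)(B − cW)ᴴ)`, `W = VᴴBV`, `|c| = 1`). [folklore] -/
theorem hs_axis_bound (B V : Matrix (Fin n) (Fin n) ℂ) (hV : V ∈ Matrix.unitaryGroup (Fin n) ℂ) :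
    ‖(B * V * Bᴴ * Vᴴ).trace‖ ≤ ((B * Bᴴ).trace).re := by
  have hVV' : V * Vᴴ = 1 := Matrix.mem_unitaryGroup_iff.mp hV
  have hzW : (B * V * Bᴴ * Vᴴ).trace = (Vᴴ * B * V * Bᴴ).trace := by
    rw [Matrix.trace_mul_comm]
    simp only [Matrix.mul_assoc]
  have hWW : ((Vᴴ * B * V) * (Vᴴ * B * V)ᴴ).trace = (B * Bᴴ).trace := by
    have h1 : (Vᴴ * B * V) * (Vᴴ * B * V)ᴴ = Vᴴ * (B * Bᴴ) * V := by
      simp only [Matrix.conjTranspose_mul, Matrix.conjTranspose_conjTranspose, Matrix.mul_assoc]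
      rw [← Matrix.mul_assoc V Vᴴ, hVV', Matrix.one_mul]
    rw [h1, Matrix.mul_assoc, Matrix.trace_mul_comm, Matrix.mul_assoc, hVV', Matrix.mul_one]
  have hBW : (B * (Vᴴ * B * V)ᴴ).trace = star ((Vᴴ * B * V * Bᴴ).trace) := by
    rw [← Matrix.trace_conjTranspose, Matrix.conjTranspose_mul (Vᴴ * B * V) Bᴴ,
      Matrix.conjTranspose_conjTranspose]
  set W : Matrix (Fin n) (Fin n) ℂ := Vᴴ * B * V with hW
  set z : ℂ := (W * Bᴴ).trace with hz
  rw [hzW]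
  change ‖z‖ ≤ ((B * Bᴴ).trace).re
  have key : ∀ c : ℂ, ‖c‖ = 1 → (c * z).re ≤ ((B * Bᴴ).trace).re := by
    intro c hc
    have hcc : c * star c = 1 := by
      rw [Complex.star_def, Complex.mul_conj, Complex.normSq_eq_norm_sq, hc]
      simp
    have hpos := re_trace_mul_conjTranspose_nonneg (B - c • W)
    have hexp : ((B - c • W) * (B - c • W)ᴴ).trace =
        (B * Bᴴ).trace - star c * (B * Wᴴ).trace - c * (W * Bᴴ).trace
          + c * star c * (W * Wᴴ).trace := by
      simp only [Matrix.conjTranspose_sub, Matrix.conjTranspose_smul, Matrix.sub_mul,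
        Matrix.mul_sub, Matrix.smul_mul, Matrix.mul_smul, Matrix.trace_sub, Matrix.trace_smul,
        smul_eq_mul, smul_sub]
      ring
    rw [hexp, hcc, one_mul, hBW, hWW] at hpos
    have hre : (star c * star z).re = (c * z).re := by
      rw [← star_mul', Complex.star_def, Complex.conj_re]
    simp only [Complex.sub_re, Complex.add_re] at hpos
    rw [hre] at hpos
    linarith
  by_cases h0 : z = 0
  · rw [h0, norm_zero]; exact re_trace_mul_conjTranspose_nonneg B
  · have hzpos : 0 < ‖z‖ := norm_pos_iff.mpr h0
    have hne : (‖z‖ : ℂ) ≠ 0 := by exact_mod_cast hzpos.ne'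
    have hc : ‖(starRingEnd ℂ z) / (‖z‖ : ℂ)‖ = 1 := by
      rw [norm_div, Complex.norm_conj, Complex.norm_real, Real.norm_eq_abs, abs_of_pos hzpos,
        div_self hzpos.ne']
    have hcz : (starRingEnd ℂ z) / (‖z‖ : ℂ) * z = (‖z‖ : ℂ) := by
      rw [div_mul_eq_mul_div, Complex.conj_mul', div_eq_iff hne]
      ring
    have := key _ hc
    rw [hcz, Complex.ofReal_re] at this
    exact this

/-- **`HilbertSchmidtAxisBound` holds** (sorry-free, standard axioms). [folklore] -/
theorem hilbertSchmidtAxisBound_holds : HilbertSchmidtAxisBound :=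
  fun _ B V hV => hs_axis_bound B V hV

end HSProof


/-! ### `LogConvexTransport` is provable now (and proved) -/

section LCProof

open Real Finset

/-- Transport of one anchor by discrete log-convexity + symmetry (the analytic core of the
longitudinal transport; sorry-free). [folklore] -/
theorem logConvexTransport
    (C : ℕ → ℝ) (L ℓ₀ : ℕ) (A ε : ℝ)
    (hpos : ∀ n, n ≤ L → 0 < C n)
    (hconv : ∀ n, n + 2 ≤ L → C (n + 1) ^ 2 ≤ C n * C (n + 2))
    (hsym : ∀ n, n ≤ L → C n = C (L - n))
    (hA : C 0 ≤ A) (hε : 0 < ε) (hεA : ε ≤ A) (hanchor : ε ≤ C ℓ₀) (hℓ₀ : 1 ≤ ℓ₀)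
    (hℓ₀L : 2 * ℓ₀ ≤ L) :
    ∀ n : ℕ, 2 * n ≤ L → ε * (ε / A) ^ ((n : ℝ) / ℓ₀) ≤ C n := by
  -- f = log C, d = forward slope
  set f : ℕ → ℝ := fun n => Real.log (C n) with hf
  set d : ℕ → ℝ := fun n => f (n + 1) - f n with hd
  have hApos : 0 < A := lt_of_lt_of_le hε hεA
  -- S1: slopes non-decreasing
  have S1 : ∀ n, n + 2 ≤ L → d n ≤ d (n + 1) := by
    intro n hn
    have h0 : 0 < C n := hpos n (by omega)
    have h1 : 0 < C (n + 1) := hpos (n + 1) (by omega)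
    have h2 : 0 < C (n + 2) := hpos (n + 2) (by omega)
    have hlog := Real.log_le_log (by positivity) (hconv n hn)
    rw [Real.log_pow, Real.log_mul h0.ne' h2.ne'] at hlog
    simp only [hd, hf]
    have e : (n + 1 + 1) = n + 2 := by ring
    rw [e]
    push_cast at hlog
    linarith
  -- S2: chained
  have S2 : ∀ m n, m ≤ n → n + 1 ≤ L → d m ≤ d n := by
    intro m n hmn hnL
    induction n, hmn using Nat.le_induction with
    | base => exact le_rfl
    | succ k hmk ih =>
        exact le_trans (ih (by omega)) (S1 k (by omega))
  -- S3: antisymmetry of slopes under n ↦ L - n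
  have S3 : ∀ m, m + 1 ≤ L → d (L - m - 1) = - d m := by
    intro m hm
    have e1 : L - m - 1 + 1 = L - m := by omega
    have hA1 : C (L - m) = C m := (hsym m (by omega)).symm
    have hA2 : C (L - m - 1) = C (m + 1) := by
      rw [hsym (m + 1) hm, Nat.sub_sub]
    simp only [hd, hf, e1, hA1, hA2]
    ring
  -- S4: slopes nonpositive on the first half
  have S4 : ∀ m, 2 * m + 1 ≤ L → d m ≤ 0 := by
    intro m hm
    have h := S2 m (L - m - 1) (by omega) (by omega)
    rw [S3 m (by omega)] at h
    linarith
  -- monotone decrease up to ℓ₀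
  have mono : ∀ j n, n + j ≤ ℓ₀ → f (n + j) ≤ f n := by
    intro j
    induction j with
    | zero => intro n _; simp
    | succ j ih =>
        intro n hnj
        have hstep : d (n + j) ≤ 0 := S4 (n + j) (by omega)
        simp only [hd] at hstep
        have := ih n (by omega)
        have e : n + (j + 1) = n + j + 1 := by ring
        rw [e]
        linarith
  have S5 : ∀ n, n ≤ ℓ₀ → f ℓ₀ ≤ f n := by
    intro n hn
    have := mono (ℓ₀ - n) n (by omega)
    have e : n + (ℓ₀ - n) = ℓ₀ := by omega
    rw [e] at this
    exact this
  -- telescoping: f (a + N) - f a = Σ_{i<N} d (a + i)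
  have tele : ∀ a N, f (a + N) - f a = ∑ i ∈ range N, d (a + i) := by
    intro a N
    have h := Finset.sum_range_sub (fun i => f (a + i)) N
    simp only [add_zero] at h
    rw [← h]
    apply Finset.sum_congr rfl
    intro i _
    simp only [hd, add_assoc]
  -- S6a: f ℓ₀ - f 0 ≤ ℓ₀ * d (ℓ₀ - 1)
  have S6a : f ℓ₀ - f 0 ≤ ℓ₀ * d (ℓ₀ - 1) := by
    have h := tele 0 ℓ₀
    simp only [zero_add] at h
    rw [h]
    have hb : ∀ i ∈ range ℓ₀, d i ≤ d (ℓ₀ - 1) := by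
      intro i hi
      rw [Finset.mem_range] at hi
      exact S2 i (ℓ₀ - 1) (by omega) (by omega)
    calc ∑ i ∈ range ℓ₀, d i ≤ ∑ i ∈ range ℓ₀, d (ℓ₀ - 1) := Finset.sum_le_sum hb
      _ = ℓ₀ * d (ℓ₀ - 1) := by simp
  -- S6b: for ℓ₀ ≤ n, 2n ≤ L:  f n - f ℓ₀ ≥ (n - ℓ₀) * d (ℓ₀ - 1)
  have S6b : ∀ n, ℓ₀ ≤ n → 2 * n ≤ L → ((n : ℝ) - ℓ₀) * d (ℓ₀ - 1) ≤ f n - f ℓ₀ := by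
    intro n hn h2n
    obtain ⟨N, rfl⟩ : ∃ N, n = ℓ₀ + N := ⟨n - ℓ₀, by omega⟩
    rw [tele ℓ₀ N]
    have hb : ∀ i ∈ range N, d (ℓ₀ - 1) ≤ d (ℓ₀ + i) := by
      intro i hi
      rw [Finset.mem_range] at hi
      exact S2 (ℓ₀ - 1) (ℓ₀ + i) (by omega) (by omega)
    calc ((ℓ₀ + N : ℕ) - (ℓ₀ : ℝ)) * d (ℓ₀ - 1) = ∑ i ∈ range N, d (ℓ₀ - 1) := by
            push_cast; simp
      _ ≤ ∑ i ∈ range N, d (ℓ₀ + i) := Finset.sum_le_sum hb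
  -- anchors in log form
  have hf0 : f 0 ≤ Real.log A := Real.log_le_log (hpos 0 (by omega)) hA
  have hfℓ : Real.log ε ≤ f ℓ₀ := Real.log_le_log hε hanchor
  have hlogdiv : Real.log (ε / A) = Real.log ε - Real.log A := Real.log_div hε.ne' hApos.ne'
  have hlogεA : Real.log (ε / A) ≤ 0 := by
    apply Real.log_nonpos (by positivity)
    rw [div_le_one hApos]; exact hεA
  have hℓ₀pos : (0 : ℝ) < ℓ₀ := by exact_mod_cast hℓ₀
  -- main: log lower bound  f n ≥ log ε + (n/ℓ₀) log(ε/A)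
  intro n h2n
  have main : Real.log ε + ((n : ℝ) / ℓ₀) * Real.log (ε / A) ≤ f n := by
    by_cases hn : n ≤ ℓ₀
    · have h1 := S5 n hn
      have h2 : ((n : ℝ) / ℓ₀) * Real.log (ε / A) ≤ 0 :=
        mul_nonpos_of_nonneg_of_nonpos (by positivity) hlogεA
      linarith
    · have hn' : ℓ₀ ≤ n := by omega
      have h1 := S6b n hn' h2n
      -- ℓ₀ * d(ℓ₀ - 1) ≥ log ε - log A
      have hdl : Real.log (ε / A) ≤ (ℓ₀ : ℝ) * d (ℓ₀ - 1) := by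
        rw [hlogdiv]; linarith [S6a]
      -- t := (n - ℓ₀)/ℓ₀ ≥ 0 and t = n/ℓ₀ - 1
      have ht0 : (0 : ℝ) ≤ ((n : ℝ) - ℓ₀) / ℓ₀ := by
        apply div_nonneg _ hℓ₀pos.le
        have : (ℓ₀ : ℝ) ≤ n := by exact_mod_cast hn'
        linarith
      have ht : ((n : ℝ) - ℓ₀) / ℓ₀ = (n : ℝ) / ℓ₀ - 1 := by
        rw [sub_div, div_self hℓ₀pos.ne']
      have h1' : (((n : ℝ) - ℓ₀) / ℓ₀) * ((ℓ₀ : ℝ) * d (ℓ₀ - 1)) ≤ f n - f ℓ₀ := by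
        have e : (((n : ℝ) - ℓ₀) / ℓ₀) * ((ℓ₀ : ℝ) * d (ℓ₀ - 1)) = ((n : ℝ) - ℓ₀) * d (ℓ₀ - 1) := by
          rw [div_mul_eq_mul_div, div_eq_iff hℓ₀pos.ne']
          ring
        rw [e]; exact h1
      have h3 : (((n : ℝ) - ℓ₀) / ℓ₀) * Real.log (ε / A)
          ≤ (((n : ℝ) - ℓ₀) / ℓ₀) * ((ℓ₀ : ℝ) * d (ℓ₀ - 1)) :=
        mul_le_mul_of_nonneg_left hdl ht0
      rw [ht] at h3
      have h4 : ((n : ℝ) / ℓ₀ - 1) * Real.log (ε / A)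
          = ((n : ℝ) / ℓ₀) * Real.log (ε / A) - Real.log (ε / A) := by ring
      rw [h4] at h3
      rw [ht] at h1'
      linarith
  -- exponentiate
  have hCn : 0 < C n := hpos n (by omega)
  have hbase : 0 < ε / A := by positivity
  calc ε * (ε / A) ^ ((n : ℝ) / ℓ₀)
        = Real.exp (Real.log ε + ((n : ℝ) / ℓ₀) * Real.log (ε / A)) := by
          rw [Real.exp_add, Real.exp_log hε, Real.rpow_def_of_pos hbase,
            mul_comm (Real.log (ε / A)) ((n : ℝ) / ℓ₀)]
    _ ≤ Real.exp (f n) := Real.exp_le_exp.mpr main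
    _ = C n := by simp only [hf]; exact Real.exp_log hCn

/-- **`LogConvexTransport` holds** (sorry-free, standard axioms). [folklore] -/
theorem logConvexTransport_holds : LogConvexTransport :=
  fun C L ℓ₀ A ε hpos hconv hsym hA hε hεA hanchor hℓ₀ hℓ₀L =>
    logConvexTransport C L ℓ₀ A ε hpos hconv hsym hA hε hεA hanchor hℓ₀ hℓ₀L

end LCProof


/-! ### `LyapunovLowerInterpolation` is provable now (and proved) -/

section LyProof

open MeasureTheory Real

/-- Lyapunov's inequality in lower-interpolation form (Hölder with exponents `1/θ`, `1/(1−θ)`,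
`θ = (p−2)/(p−s)`; sorry-free). [cite: HardyLittlewoodPolya1952, Thm 18 and Thm 193 (Lyapunov)] -/
theorem lyapunov_lower
    (Ω : Type) [MeasurableSpace Ω] (μ : Measure Ω) [IsProbabilityMeasure μ] (X : Ω → ℝ) (s p : ℝ)
    (hXm : Measurable X) (hX0 : ∀ ω, 0 ≤ X ω) (hs : 0 < s) (hs2 : s < 2) (hp : 2 < p)
    (hint : Integrable (fun ω => X ω ^ p) μ) :
    (∫ ω, X ω ^ (2 : ℝ) ∂μ) ^ (p - s) ≤ (∫ ω, X ω ^ s ∂μ) ^ (p - 2) * (∫ ω, X ω ^ p ∂μ) ^ (2 - s) := by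
  -- exponents
  have hps : 0 < p - s := by linarith
  set θ : ℝ := (p - 2) / (p - s) with hθ
  have hθ0 : 0 < θ := div_pos (by linarith) hps
  have hθ1 : θ < 1 := by rw [hθ, div_lt_one hps]; linarith
  have h1θ : 0 < 1 - θ := by linarith
  set a : ℝ := θ * s with ha
  set b : ℝ := (1 - θ) * p with hb
  have ha0 : 0 < a := mul_pos hθ0 hs
  have hb0 : 0 < b := mul_pos h1θ (by linarith)
  have hab : a + b = 2 := by
    simp only [ha, hb, hθ]
    field_simp
    ring
  set P : ℝ := 1 / θ with hP
  set Q : ℝ := 1 / (1 - θ) with hQ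
  have hP0 : 0 < P := by rw [hP]; positivity
  have hQ0 : 0 < Q := by rw [hQ]; positivity
  have hP1 : 1 < P := by
    rw [hP, one_div, one_lt_inv_iff₀]; exact ⟨hθ0, hθ1⟩
  have hPQ : P.HolderConjugate Q := by
    rw [Real.holderConjugate_iff_eq_conjExponent hP1, hQ, hP]
    have hθne : θ ≠ 0 := hθ0.ne'
    have h1θne : 1 - θ ≠ 0 := h1θ.ne'
    field_simp
  have haP : a * P = s := by simp only [ha, hP]; field_simp
  have hbQ : b * Q = p := by simp only [hb, hQ]; field_simp
  -- the two factors
  set f : Ω → ℝ := fun ω => X ω ^ a with hf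
  set g : Ω → ℝ := fun ω => X ω ^ b with hg
  have hf0 : ∀ ω, 0 ≤ f ω := fun ω => Real.rpow_nonneg (hX0 ω) a
  have hg0 : ∀ ω, 0 ≤ g ω := fun ω => Real.rpow_nonneg (hX0 ω) b
  have hfg : ∀ ω, f ω * g ω = X ω ^ (2 : ℝ) := by
    intro ω
    simp only [hf, hg]
    rw [← Real.rpow_add' (hX0 ω) (by rw [hab]; norm_num), hab]
  have hfP : ∀ ω, f ω ^ P = X ω ^ s := by
    intro ω; simp only [hf]; rw [← Real.rpow_mul (hX0 ω), haP]
  have hgQ : ∀ ω, g ω ^ Q = X ω ^ p := by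
    intro ω; simp only [hg]; rw [← Real.rpow_mul (hX0 ω), hbQ]
  -- measurability
  have hfm : Measurable f := hXm.pow_const a
  have hgm : Measurable g := hXm.pow_const b
  -- integrability of X^s (dominated by 1 + X^p)
  have hXs_int : Integrable (fun ω => X ω ^ s) μ := by
    have hdom : ∀ ω, ‖X ω ^ s‖ ≤ 1 + X ω ^ p := by
      intro ω
      rw [Real.norm_of_nonneg (Real.rpow_nonneg (hX0 ω) s)]
      rcases le_or_gt (X ω) 1 with h | h
      · have : X ω ^ s ≤ 1 := Real.rpow_le_one (hX0 ω) h hs.le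
        linarith [Real.rpow_nonneg (hX0 ω) p]
      · have : X ω ^ s ≤ X ω ^ p := Real.rpow_le_rpow_of_exponent_le h.le (by linarith)
        linarith
    refine Integrable.mono' ((integrable_const 1).add hint) ?_ (Filter.Eventually.of_forall hdom)
    exact (hXm.pow_const s).aestronglyMeasurable
  -- MemLp conditions
  have hPne0 : ENNReal.ofReal P ≠ 0 := by
    simp only [ne_eq, ENNReal.ofReal_eq_zero, not_le]; exact hP0
  have hQne0 : ENNReal.ofReal Q ≠ 0 := by
    simp only [ne_eq, ENNReal.ofReal_eq_zero, not_le]; exact hQ0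
  have hfLp : MemLp f (ENNReal.ofReal P) μ := by
    rw [← integrable_norm_rpow_iff hfm.aestronglyMeasurable hPne0 ENNReal.ofReal_ne_top]
    rw [ENNReal.toReal_ofReal hP0.le]
    have : (fun ω => ‖f ω‖ ^ P) = fun ω => X ω ^ s := by
      funext ω; rw [Real.norm_of_nonneg (hf0 ω), hfP]
    rw [this]; exact hXs_int
  have hgLp : MemLp g (ENNReal.ofReal Q) μ := by
    rw [← integrable_norm_rpow_iff hgm.aestronglyMeasurable hQne0 ENNReal.ofReal_ne_top]
    rw [ENNReal.toReal_ofReal hQ0.le]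
    have : (fun ω => ‖g ω‖ ^ Q) = fun ω => X ω ^ p := by
      funext ω; rw [Real.norm_of_nonneg (hg0 ω), hgQ]
    rw [this]; exact hint
  -- Hölder
  have holder := integral_mul_le_Lp_mul_Lq_of_nonneg hPQ (Filter.Eventually.of_forall hf0)
    (Filter.Eventually.of_forall hg0) hfLp hgLp
  have hL : ∫ ω, f ω * g ω ∂μ = ∫ ω, X ω ^ (2 : ℝ) ∂μ := integral_congr_ae (Filter.Eventually.of_forall hfg)
  have hR1 : ∫ ω, f ω ^ P ∂μ = ∫ ω, X ω ^ s ∂μ := integral_congr_ae (Filter.Eventually.of_forall hfP)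
  have hR2 : ∫ ω, g ω ^ Q ∂μ = ∫ ω, X ω ^ p ∂μ := integral_congr_ae (Filter.Eventually.of_forall hgQ)
  rw [hL, hR1, hR2] at holder
  -- holder : ∫X² ≤ (∫X^s)^(1/P) * (∫X^p)^(1/Q)  with 1/P = θ, 1/Q = 1-θ
  have hPinv : 1 / P = θ := by rw [hP, one_div_one_div]
  have hQinv : 1 / Q = 1 - θ := by rw [hQ, one_div_one_div]
  rw [hPinv, hQinv] at holder
  -- nonnegativity of the integrals
  have I2 : 0 ≤ ∫ ω, X ω ^ (2 : ℝ) ∂μ := integral_nonneg fun ω => Real.rpow_nonneg (hX0 ω) _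
  have Is : 0 ≤ ∫ ω, X ω ^ s ∂μ := integral_nonneg fun ω => Real.rpow_nonneg (hX0 ω) _
  have Ip : 0 ≤ ∫ ω, X ω ^ p ∂μ := integral_nonneg fun ω => Real.rpow_nonneg (hX0 ω) _
  -- raise to the power (p - s)
  have hmono := Real.rpow_le_rpow I2 holder hps.le
  rw [Real.mul_rpow (Real.rpow_nonneg Is _) (Real.rpow_nonneg Ip _), ← Real.rpow_mul Is,
    ← Real.rpow_mul Ip] at hmono
  have e1 : θ * (p - s) = p - 2 := by simp only [hθ]; field_simp
  have e2 : (1 - θ) * (p - s) = 2 - s := by simp only [hθ]; field_simp; ring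
  rw [e1, e2] at hmono
  exact hmono

/-- **`LyapunovLowerInterpolation` holds** (sorry-free, standard axioms). [folklore] -/
theorem lyapunovLowerInterpolation_holds : LyapunovLowerInterpolation :=
  fun Ω _ μ _ X s p hXm hX0 hs hs2 hp hint => lyapunov_lower Ω μ X s p hXm hX0 hs hs2 hp hint

end LyProof

end Summit.QuantumFields.QCD.Cruxes.OneScaleTrajectory.RpAxisAnchor
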